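import Summits.QuantumFields.YangMills.Theorems.BalabanUVNodesN14BinderAtSpineReadingOfRecord13CoPHV
import Summits.QuantumFields.YangMills.Theorems.BalabanUVNodesN19ClassSandwichAtRecord

/-!
# BalabanUVNodes ∕ N14 — THE U3 CLASS-LAW ROADS AT THE **V** SPINE READING OF RECORD `crOfRecord₁₃VAt K₀ jc sh` (dag-n20-d p590105) WITH n21-d's SHELL SPLIT OF RECORD:
# K3⁷ v4 stub 2's N19′ conjunct at a live tuple in THREE U3 currencies on the SHELL-FREE CLASS LAWS OF RECORD, and (V) ⟺ MASS_cl — node N14's (I)-binder is read on NONE of them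

Cell `pub-ymgap` (HUMAN RULING D-0062 Track A; director-ym №197 ∕ HUMAN RULING D-0149), WIDTH SEAT `pub-ymgap-dag-n14-w2` (g3), CLAIM-1 ∕ INTENT-1 (bus 2026-08-28T02:45Z); executes
g2's booked FILE-4 idea («(V) ⟺ MASS_cl … n19-c's N&S invariant») on this lineage's own objects.  Filed `--kind proof --supports stmt-QuantumFields-20544 --as helper` (K3⁷
`SpineGivenEndpointR13SepCoPH`).  COUNT-NEUTRAL.  THEOREMS ONLY (0 `def`); imports g2's `…N14BinderAtSpineReadingOfRecord13CoPHV` (p596111: `classMeasA₁₃ ∕ B₁₃`, `mgfForm_weightA₁₃ ∕ B₁₃`,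
`shellMeasA₁₃ ∕ B₁₃`, `mgfForm_shellA₁₃ ∕ B₁₃`, `shellMeasA₁₃_le ∕ B₁₃_le`; n20-d's `crOfRecord₁₃VAt`, `core_crOfRecord₁₃VAt`) and dag-n19-d's `…N19ClassSandwichAtRecord` (p500938 ∕ v1.1:
`core_of_classSandwich_atKeys`, `core_of_mass_of_tv_map₂`, `prodObs_eq_prodW_comp_A`; through it dag-n19-c's `N19ClassSandwichRoad.classSandwich_of_mass_of_shape` ∕ `shapeSandwich_of_shapeDensity`
p496221 and `N19CoreTVInvariant.core_of_mass_of_tv` p504410) — all BY NAME; edits nothing; `N`-∕`K₀`-generic; no Theses import.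

WHAT.  At one Stage-13 tuple with core provisos on the live-selector line (laws (H-ζ) ∕ `0 ≤ ζ` displayed), g2 typed K3⁷ stub 2's N19′ conjunct `NE7.Core … (cr…).δ ∧ Summable (cr…).δ` at
`cr := crOfRecord₁₃VAt K₀ jc sh` on ROAD (ii) (`…V.core_crOfRecord₁₃VAt[_shellSplitOfRecord]_of_coreZero_of_tv`): (V) the vacuum bracket on the undressed shell-free class WEIGHTS + (I) U3's TV
sentence on the shell-free class LAWS pushed to the unit lattice, THROUGH N14's (I)-binder `TiltedMeanMatching`.  This file reads the same conjunct on dag-n19-c's CLASS-LAW roads, whose inputs are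
sentences about the two runs' SHELL-FREE CLASS MEASURES OF RECORD `classMeasA₁₃ − νshA` ∕ `classMeasB₁₃ − νshB` (generic MGF-part shell split) resp. `classMeasA₁₃ − shellMeasA₁₃ ρA` ∕
`classMeasB₁₃ − shellMeasB₁₃ ρB` (n21-d's `shellSplitOfRecord₁₃At`), pushed to `GaugeField (F.P 0) 0 (SU N)` by the tuple's own canonical `T4RunLadder.unitFactorisation`:
(K3⁷ SKELETON OF RECORD = v4 17c74fac127b5f61, plan g82 l.27703: `KeyedCoreEdgeHolderD4 β cr rr` is keyed `guards → Adm → (B) → Endpoint → ForSmallCouplings D fun g₀ => ∀ os, PHolderD4 … → ∃ δ, …`;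
every theorem below is the face AT ONE TUPLE AND `g₀ ∕ os`, plugged by the plan's re-key recipe `fun F θ hP hG hθ _ _ => ForSmallCouplings.of_forall fun g₀ os => ⟨face⟩` — the rates are NOT read.)
* §1 `coreZero_iff_massSandwich` — (V) READ IN MEASURE WORDS: g2's displayed hypothesis `h0` (`NE7.Core 1 (F.side^4) T Bad (K,·,x ↦ wA K 0 x − shA K 0 x) (… wB − shB …) δ₀`) IS the
  ONE-constant sandwich of the MASSES of the shell-free class measures of record, width `F.side^4·δ₀ K` (`MGFForm.zero_eq`; `Iff`) · `coreZero_shellSplitOfRecord_iff_massSandwich`.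
  So road (ii)'s input pair at the reading of record is exactly U3's pair (MASS_cl, TV_cl).
* §2 ROAD (iii) ★★ `core_crOfRecord₁₃VAt_of_classSandwich` (generic `sh`) · ★★ `core_crOfRecord₁₃VAt_shellSplitOfRecord_of_classSandwich`: NE7-S_cl — for every `K` ONE constant `c` with
  `e^{c − r K}·lawA ≤ lawB ≤ e^{c + r K}·lawA` AS MEASURES on the unit lattice on every good key, `Σ r < ∞` ⇒ the N19′ conjunct at the reading's OWN carriers and canonical `δ`
  (`core_of_classSandwich_atKeys` + `core_crOfRecord₁₃VAt`).  NO vacuum bracket, NO (I)-binder, every `t` of the window at once.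
* §3 ROAD (iii)′ ★★ `core_crOfRecord₁₃VAt_of_massSandwich_of_tv` · ★★ `core_crOfRecord₁₃VAt_shellSplitOfRecord_of_massSandwich_of_tv`: MASS_cl(`r₁`) of the shell-free class measures (in n19-c's
  `ℝ≥0∞` letters, on the runs' OWN spaces — push-forward does not change a mass) ∧ TV_cl(`ρ`) of the normalised pushed-forward shell-free class laws on measurable sets (g2's `hTV` VERBATIM),
  `Σ r₁, Σ ρ < ∞` ⇒ the N19′ conjunct DIRECTLY (`core_of_mass_of_tv_map₂`: width `r₁ + (e² − 1)ρ`; n19-c: «NO (I)-binder, NO mean-value step») — the SAME input pair as g2's road (ii) by §1;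
  generic two-key glue `massSandwich_map₂` (MASS_cl pushes forward unchanged; companion of n19-c's `classSandwich_map` ∕ `tvSandwich_map`).
* §4 ROAD (iii)″ ★ `core_crOfRecord₁₃VAt_shellSplitOfRecord_of_massSandwich_of_shapeDensity`: MASS_cl(`r₁`) ∧ SHAPE_cl in DENSITY form (dag-n19-w2's `hSh`, g2 §1's text on the shell-free laws:
  `lawB = e^{c}·lawA.withDensity e^{g}`, `|g| ≤ r₂ K`), `Σ r₁, Σ r₂ < ∞` ⇒ the N19′ conjunct (`shapeSandwich_of_shapeDensity` + `classSandwich_of_mass_of_shape`, width `r₁ + 2r₂`, + §2).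

LOCATED N14 CONSEQUENCE (for plan g82's K3⁷ v4 kit README ∕ START LIST v9 and dag-lead; count-neutral).  On all three class-law roads K3⁷ v4 stub 2's N19′ conjunct at the pinned reading follows
WITHOUT node N14's (I)-binder `DressedMGFForm.TiltedMeanMatching`; g2's road (ii) reads the binder, but by §1 its input pair is the same (MASS_cl = (V), TV_cl).  Hence at the spine reading
of record node N14 = NE1′ («dressed stability, observable-attached, μ-uniform») carries NO stub-2 obligation beyond node U3's class-law sentence, and at stub 1 its K4 slot `N14At R.ne1` is the
observable budget under dag-n14-w1's pin (`Ne1PinnedOfRecord`, p593177 ∕ p597335) — director-ym №195 (8) «N14 DEPENDENT on §N19 s1 ∕ U3» made kernel-explicit where the stubs read it.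

HONEST FRAMING.  Order arithmetic on measures + by-name composition ([folklore] ∕ bookkeeping).  ZERO ESTIMATE CONTENT: NE7-S_cl, MASS_cl, TV_cl, SHAPE_cl are HYPOTHESIS SHAPES produced
by nobody — UNPRINTED two-run statements for d = 4 ([Balaban1985UV3] (41) p.266 ∕ (47) p.267 print a Z-level sandwich for d = 3; names only); the live-selector pin and the laws (H-ζ) ∕
`0 ≤ ζ` are displayed, claimed for no tuple (K0⁷ OPEN); nothing of Bałaban's is asserted; NE7 ∕ NE1′ NOT PRINTED as two-run statements and NOT PROVED; N14 ∕ N19 ∕ N21 NOT discharged;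
K3⁷ OPEN, NOT claimed; counts UNMOVED (typed 28∕28 · discharged 5∕27, A 5∕28); one finite four-torus programme at fixed `ε = L^{−K}` — the YM mass gap (Clay) is NOT proved by any of
this: R4 closes only the conditional finite-𝕋⁴ rung `BalabanLadder.UV`; NOT ℝ⁴, NOT OS, NOT a mass gap, NOT Clay.  0 `def`, 0 `sorry`, standard axioms; no decl below carries a cite tag.
-/

set_option autoImplicit false

noncomputable section

open MeasureTheory ProbabilityTheory Finset
open scoped ENNReal BigOperators Matrix.Norms.L2Operator

namespace YMDAG.N14.AtSpineReading13CoPH.V.ClassLawRoads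

open Literature.MathematicalPhysics.QuantumFieldTheory.Balaban1983to89
open Literature.MathematicalPhysics.QuantumFieldTheory.Balaban1983to89.T4Continuum
open Literature.MathematicalPhysics.QuantumFieldTheory.Balaban1983to89.Node00
open B14.Eq218Concrete
open Summit.QuantumFields.BalabanUV.T4Continuum.Spine
open Summit.QuantumFields.BalabanUV.T4Continuum.NE1p.DressedMGFForm (MGFForm TiltedMeanMatching)
open Summit.QuantumFields.YangMills.BalabanUVNodes.N19ClassSandwichRoad (classSandwich_of_mass_of_shape shapeSandwich_of_shapeDensity)
open Summit.QuantumFields.YangMills.BalabanUVNodes.N19ClassSandwichAtRecord (core_of_classSandwich_atKeys core_of_mass_of_tv_map₂ prodObs_eq_prodW_comp_A measurable_prodW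
  abs_prodW_le_one)
open YMDAG.UVSplit
open YMDAG.N14.AtSpineReading13CoPH

variable {F : T4Family} {N : ℕ} [NeZero N] (θ : Stage13HParams F N) (hP : θ.Provisos₁₃CoPH F N) (K₀ : ℕ) (jcut : ℕ → ℕ) (sh : ShellSplit₁₃CoPH N K₀)

/-! ## §1 (V) READ IN MEASURE WORDS: the vacuum bracket IS the mass sandwich of the shell-free class measures of record -/

/-- **(V) ⟺ MASS_cl AT THE READING OF RECORD.**  At one Stage-13 tuple with core provisos on the live-selector line (laws (H-ζ) ∕ `0 ≤ ζ`), for ANY shell split `sh` whose parts are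
MGFs over sub-measures `νshA ≤ classMeasA₁₃`, `νshB ≤ classMeasB₁₃` (MGF-part form): g2's displayed hypothesis (V) — `NE7.Core 1 (F.side^4)` on the UNDRESSED shell-free class weights
`wA K 0 x − shA K 0 x` ∕ `wB K 0 x − shB K 0 x` — holds IFF for every `K` ONE constant `c` sandwiches the MASSES of the shell-free class measures of record on every good key:
`e^{c − F.side^4·δ₀ K}·mass(classMeasA₁₃ − νshA) ≤ mass(classMeasB₁₃ − νshB) ≤ e^{c + F.side^4·δ₀ K}·mass(classMeasA₁₃ − νshA)` (`MGFForm.zero_eq` under `MGFForm.sub`).  So road (ii)'s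
input pair ((V), TV) is node U3's pair (MASS_cl, TV_cl). [folklore] -/
theorem coreZero_iff_massSandwich (E : B12.RunParams → ℝ) (hsel : θ.ppSel = ppSelLiveOfRecord F N θ.ν θ.τ9 E (wOfRecord₉ F N θ.toStage9Params))
    (hζm : ZetaMeasurable F N θ.ζ) (hζ0 : ∀ p g k s Pl Ql RS U V', 0 ≤ θ.ζ p g k s Pl Ql RS U V') (g₀ : ℕ → ℝ) (os : List (ULoop F)) {δ₀ : ℕ → ℝ}
    {νshA : ∀ K, (Σ K, SiteSeqKey F (K₀ + K)) → Measure (GaugeField (F.P (K₀ + K)) 0 (Node00.SU N))}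
    {νshB : ∀ K, (Σ K, SiteSeqKey F (K₀ + K)) → Measure (GaugeField (F.P (K₀ + K + 1)) 0 (Node00.SU N))}
    (hshA : MGFForm 1 (classSet₁₃ θ K₀ g₀)
      (fun K (U : GaugeField (F.P (K₀ + K)) 0 (Node00.SU N)) => T4GenFunBounds.prodObs ((datumOfRecord₁₃CoPH F N θ hP).scheme g₀) (K₀ + K) os U) νshA (sh F θ hP g₀ os).1)
    (hleA : ∀ K, ∀ x ∈ classSet₁₃ θ K₀ g₀ K, νshA K x ≤ classMeasA₁₃ θ K₀ g₀ K x)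
    (hshB : MGFForm 1 (classSet₁₃ θ K₀ g₀)
      (fun K (U : GaugeField (F.P (K₀ + K + 1)) 0 (Node00.SU N)) => T4GenFunBounds.prodObs ((datumOfRecord₁₃CoPH F N θ hP).scheme g₀) (K₀ + K + 1) os U) νshB (sh F θ hP g₀ os).2)
    (hleB : ∀ K, ∀ x ∈ classSet₁₃ θ K₀ g₀ K, νshB K x ≤ classMeasB₁₃ θ K₀ g₀ K x) :
    (letI : DecidableEq (Σ K, SiteSeqKey F (K₀ + K)) := Classical.decEq _
     NE7.Core 1 ((F.side : ℝ) ^ 4) (classSet₁₃ θ K₀ g₀) (badClass₁₃ θ K₀ g₀ jcut) (fun K _ x => weightA₁₃ θ hP K₀ g₀ os K 0 x - (sh F θ hP g₀ os).1 K 0 x)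
       (fun K _ x => weightB₁₃ θ hP K₀ g₀ os K 0 x - (sh F θ hP g₀ os).2 K 0 x) δ₀) ↔
    (letI : DecidableEq (Σ K, SiteSeqKey F (K₀ + K)) := Classical.decEq _
     ∀ K : ℕ, ∃ c : ℝ, ∀ t : ℝ, |t| ≤ 1 → ∀ x ∈ classSet₁₃ θ K₀ g₀ K \ badClass₁₃ θ K₀ g₀ jcut K t,
      Real.exp (c - (F.side : ℝ) ^ 4 * δ₀ K) * (classMeasA₁₃ θ K₀ g₀ K x - νshA K x).real Set.univ ≤ (classMeasB₁₃ θ K₀ g₀ K x - νshB K x).real Set.univ ∧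
        (classMeasB₁₃ θ K₀ g₀ K x - νshB K x).real Set.univ ≤ Real.exp (c + (F.side : ℝ) ^ 4 * δ₀ K) * (classMeasA₁₃ θ K₀ g₀ K x - νshA K x).real Set.univ) := by
  letI : DecidableEq (Σ K, SiteSeqKey F (K₀ + K)) := Classical.decEq _
  have hA := (mgfForm_weightA₁₃ θ K₀ hP E hsel hζm hζ0 g₀ os).sub hshA hleA
  have hB := (mgfForm_weightB₁₃ θ K₀ hP E hsel hζm hζ0 g₀ os).sub hshB hleB
  refine forall_congr' fun K => exists_congr fun c => forall_congr' fun t => forall_congr' fun _ => forall₂_congr fun x hx => ?_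
  dsimp only
  rw [hA.zero_eq K (Finset.mem_sdiff.1 hx).1, hB.zero_eq K (Finset.mem_sdiff.1 hx).1]

section ShellOfRecord₁

open Summit.QuantumFields.YangMills.Theorems.N21ShellSplitOfRecord13CoPH (shellSplitOfRecord₁₃At WidthLetter₁₃CoPH)
open YMDAG.N14.AtSpineReading13CoPH.Shell

/-- **(V) ⟺ MASS_cl AT n21-d's SHELL SPLIT OF RECORD** `shellSplitOfRecord₁₃At N K₀ ρA ρB` (any width letters): §1 with the MGF-part form DISCHARGED by g2's shell sibling
(`mgfForm_shellA₁₃ ∕ B₁₃`, `shellMeasA₁₃_le ∕ B₁₃_le`) — the vacuum bracket of g2's `core_crOfRecord₁₃VAt_shellSplitOfRecord_of_coreZero_of_tv` is the mass sandwich of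
`classMeasA₁₃ − shellMeasA₁₃ ρA` ∕ `classMeasB₁₃ − shellMeasB₁₃ ρB`. [folklore] -/
theorem coreZero_shellSplitOfRecord_iff_massSandwich (ρA ρB : WidthLetter₁₃CoPH N) (E : B12.RunParams → ℝ) (hsel : θ.ppSel = ppSelLiveOfRecord F N θ.ν θ.τ9 E (wOfRecord₉ F N θ.toStage9Params))
    (hζm : ZetaMeasurable F N θ.ζ) (hζ0 : ∀ p g k s Pl Ql RS U V', 0 ≤ θ.ζ p g k s Pl Ql RS U V') (g₀ : ℕ → ℝ) (os : List (ULoop F)) {δ₀ : ℕ → ℝ} :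
    (letI : DecidableEq (Σ K, SiteSeqKey F (K₀ + K)) := Classical.decEq _
     NE7.Core 1 ((F.side : ℝ) ^ 4) (classSet₁₃ θ K₀ g₀) (badClass₁₃ θ K₀ g₀ jcut)
       (fun K _ x => weightA₁₃ θ hP K₀ g₀ os K 0 x - ((shellSplitOfRecord₁₃At N K₀ ρA ρB) F θ hP g₀ os).1 K 0 x)
       (fun K _ x => weightB₁₃ θ hP K₀ g₀ os K 0 x - ((shellSplitOfRecord₁₃At N K₀ ρA ρB) F θ hP g₀ os).2 K 0 x) δ₀) ↔
    (letI : DecidableEq (Σ K, SiteSeqKey F (K₀ + K)) := Classical.decEq _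
     ∀ K : ℕ, ∃ c : ℝ, ∀ t : ℝ, |t| ≤ 1 → ∀ x ∈ classSet₁₃ θ K₀ g₀ K \ badClass₁₃ θ K₀ g₀ jcut K t,
      Real.exp (c - (F.side : ℝ) ^ 4 * δ₀ K) * (classMeasA₁₃ θ K₀ g₀ K x - shellMeasA₁₃ θ K₀ g₀ (ρA F θ hP g₀ os) K x).real Set.univ ≤
          (classMeasB₁₃ θ K₀ g₀ K x - shellMeasB₁₃ θ K₀ g₀ (ρB F θ hP g₀ os) K x).real Set.univ ∧
        (classMeasB₁₃ θ K₀ g₀ K x - shellMeasB₁₃ θ K₀ g₀ (ρB F θ hP g₀ os) K x).real Set.univ ≤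
          Real.exp (c + (F.side : ℝ) ^ 4 * δ₀ K) * (classMeasA₁₃ θ K₀ g₀ K x - shellMeasA₁₃ θ K₀ g₀ (ρA F θ hP g₀ os) K x).real Set.univ) :=
  coreZero_iff_massSandwich θ hP K₀ jcut (shellSplitOfRecord₁₃At N K₀ ρA ρB) E hsel hζm hζ0 g₀ os
    (mgfForm_shellA₁₃ θ K₀ hP E hsel hζm hζ0 g₀ os (ρA F θ hP g₀ os)) (fun K x _ => shellMeasA₁₃_le θ K₀ hζm g₀ (ρA F θ hP g₀ os) K x)
    (mgfForm_shellB₁₃ θ K₀ hP E hsel hζm hζ0 g₀ os (ρB F θ hP g₀ os)) (fun K x _ => shellMeasB₁₃_le θ K₀ hζm g₀ (ρB F θ hP g₀ os) K x)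

end ShellOfRecord₁

/-! ## §2 ROAD (iii): NE7-S_cl for the pushed-forward shell-free class laws ⇒ the N19′ conjunct at the reading (NO vacuum bracket, NO (I)-binder) -/

/-- **★★ ROAD (iii) AT THE V READING OF RECORD, generic shell split in MGF-part form.**  At one Stage-13 tuple with core provisos on the live-selector line (laws (H-ζ) ∕ `0 ≤ ζ`
displayed): NE7-S_cl — for every `K` ONE constant `c` with `e^{c − r K}·lawA ≤ lawB ≤ e^{c + r K}·lawA` AS MEASURES on `GaugeField (F.P 0) 0 (SU N)` on every good key `x ∈ classSet₁₃ K ∖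
badClass₁₃ jcut K t`, `|t| ≤ 1`, where `lawA ∕ lawB` are the SHELL-FREE class measures of record `classMeasA₁₃ − νshA` ∕ `classMeasB₁₃ − νshB` pushed to the unit lattice by the tuple's
own canonical `T4RunLadder.unitFactorisation` at levels `K₀ + K` ∕ `K₀ + K + 1` — and `Σ r < ∞` ⇒ `NE7.Core` at `crOfRecord₁₃VAt K₀ jcut sh …`'s OWN carriers and canonical `δ`, `∧ Summable`
(dag-n19-d `core_of_classSandwich_atKeys` at `δ := r ∕ F.side^4` + dag-n20-d `core_crOfRecord₁₃VAt`; non-negative cores from `MGFForm.sub`).  N14's binder is NOT read. [folklore] -/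
theorem core_crOfRecord₁₃VAt_of_classSandwich (E : B12.RunParams → ℝ) (hsel : θ.ppSel = ppSelLiveOfRecord F N θ.ν θ.τ9 E (wOfRecord₉ F N θ.toStage9Params))
    (hζm : ZetaMeasurable F N θ.ζ) (hζ0 : ∀ p g k s Pl Ql RS U V', 0 ≤ θ.ζ p g k s Pl Ql RS U V') (g₀ : ℕ → ℝ) (os : List (ULoop F))
    {νshA : ∀ K, (Σ K, SiteSeqKey F (K₀ + K)) → Measure (GaugeField (F.P (K₀ + K)) 0 (Node00.SU N))}
    {νshB : ∀ K, (Σ K, SiteSeqKey F (K₀ + K)) → Measure (GaugeField (F.P (K₀ + K + 1)) 0 (Node00.SU N))}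
    (hshA : MGFForm 1 (classSet₁₃ θ K₀ g₀)
      (fun K (U : GaugeField (F.P (K₀ + K)) 0 (Node00.SU N)) => T4GenFunBounds.prodObs ((datumOfRecord₁₃CoPH F N θ hP).scheme g₀) (K₀ + K) os U) νshA (sh F θ hP g₀ os).1)
    (hleA : ∀ K, ∀ x ∈ classSet₁₃ θ K₀ g₀ K, νshA K x ≤ classMeasA₁₃ θ K₀ g₀ K x)
    (hshB : MGFForm 1 (classSet₁₃ θ K₀ g₀)
      (fun K (U : GaugeField (F.P (K₀ + K + 1)) 0 (Node00.SU N)) => T4GenFunBounds.prodObs ((datumOfRecord₁₃CoPH F N θ hP).scheme g₀) (K₀ + K + 1) os U) νshB (sh F θ hP g₀ os).2)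
    (hleB : ∀ K, ∀ x ∈ classSet₁₃ θ K₀ g₀ K, νshB K x ≤ classMeasB₁₃ θ K₀ g₀ K x) {r : ℕ → ℝ}
    (hS : letI : DecidableEq (Σ K, SiteSeqKey F (K₀ + K)) := Classical.decEq _
      ∀ K : ℕ, ∃ c : ℝ, ∀ t : ℝ, |t| ≤ 1 → ∀ x ∈ classSet₁₃ θ K₀ g₀ K \ badClass₁₃ θ K₀ g₀ jcut K t,
        ENNReal.ofReal (Real.exp (c - r K)) •
            (classMeasA₁₃ θ K₀ g₀ K x - νshA K x).map
              ((T4RunLadder.unitFactorisation (datumOfRecord₁₃CoPH F N θ hP) (isPrintedAveraged_datumOfRecord₁₃CoPH F N θ hP).avgMeasurable g₀).A (K₀ + K)) ≤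
          (classMeasB₁₃ θ K₀ g₀ K x - νshB K x).map
              ((T4RunLadder.unitFactorisation (datumOfRecord₁₃CoPH F N θ hP) (isPrintedAveraged_datumOfRecord₁₃CoPH F N θ hP).avgMeasurable g₀).A (K₀ + K + 1)) ∧
        (classMeasB₁₃ θ K₀ g₀ K x - νshB K x).map
              ((T4RunLadder.unitFactorisation (datumOfRecord₁₃CoPH F N θ hP) (isPrintedAveraged_datumOfRecord₁₃CoPH F N θ hP).avgMeasurable g₀).A (K₀ + K + 1)) ≤
          ENNReal.ofReal (Real.exp (c + r K)) •
            (classMeasA₁₃ θ K₀ g₀ K x - νshA K x).map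
              ((T4RunLadder.unitFactorisation (datumOfRecord₁₃CoPH F N θ hP) (isPrintedAveraged_datumOfRecord₁₃CoPH F N θ hP).avgMeasurable g₀).A (K₀ + K)))
    (hrs : Summable r) :
    (letI := (crOfRecord₁₃VAt K₀ jcut sh F θ hP g₀ os).dec
     NE7.Core (crOfRecord₁₃VAt K₀ jcut sh F θ hP g₀ os).l₀ (crOfRecord₁₃VAt K₀ jcut sh F θ hP g₀ os).vol (crOfRecord₁₃VAt K₀ jcut sh F θ hP g₀ os).T
      (crOfRecord₁₃VAt K₀ jcut sh F θ hP g₀ os).Bad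
      (fun K t τ => (crOfRecord₁₃VAt K₀ jcut sh F θ hP g₀ os).A K t τ - (crOfRecord₁₃VAt K₀ jcut sh F θ hP g₀ os).shA K t τ)
      (fun K t τ => (crOfRecord₁₃VAt K₀ jcut sh F θ hP g₀ os).B K t τ - (crOfRecord₁₃VAt K₀ jcut sh F θ hP g₀ os).shB K t τ)
      (crOfRecord₁₃VAt K₀ jcut sh F θ hP g₀ os).δ) ∧ Summable (crOfRecord₁₃VAt K₀ jcut sh F θ hP g₀ os).δ := by
  letI : DecidableEq (Σ K, SiteSeqKey F (K₀ + K)) := Classical.decEq _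
  have hA := (mgfForm_weightA₁₃ θ K₀ hP E hsel hζm hζ0 g₀ os).sub hshA hleA
  have hB := (mgfForm_weightB₁₃ θ K₀ hP E hsel hζm hζ0 g₀ os).sub hshB hleB
  have hvol : (0 : ℝ) < (F.side : ℝ) ^ 4 := pow_pos F.side_pos 4
  have hcore := core_of_classSandwich_atKeys (T := classSet₁₃ θ K₀ g₀) (Bad := badClass₁₃ θ K₀ g₀ jcut) (l₀ := 1) (vol := (F.side : ℝ) ^ 4) (r := r)
    (δ := fun K => r K / (F.side : ℝ) ^ 4) (kA := fun K => K₀ + K) (kB := fun K => K₀ + K + 1)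
    (νA := fun K x => classMeasA₁₃ θ K₀ g₀ K x - νshA K x) (νB := fun K x => classMeasB₁₃ θ K₀ g₀ K x - νshB K x)
    (T4RunLadder.unitFactorisation (datumOfRecord₁₃CoPH F N θ hP) (isPrintedAveraged_datumOfRecord₁₃CoPH F N θ hP).avgMeasurable g₀) os hA hB hS
    (fun K => (mul_div_cancel₀ (r K) hvol.ne').symm.le)
  exact core_crOfRecord₁₃VAt K₀ jcut sh θ hP g₀ os (fun K t _ x hx => hA.nonneg' K t (Finset.mem_sdiff.1 hx).1) hcore (hrs.div_const _)


section ShellOfRecord₂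

open Summit.QuantumFields.YangMills.Theorems.N21ShellSplitOfRecord13CoPH (shellSplitOfRecord₁₃At WidthLetter₁₃CoPH)
open YMDAG.N14.AtSpineReading13CoPH.Shell

/-- **★★ ROAD (iii) AT THE V READING WITH n21-d's SHELL SPLIT OF RECORD** — K3⁷ v4 stub 2's N19′ conjunct at a live tuple (and `g₀ ∕ os`), `cr … = crOfRecord₁₃V (jc …) (shellSplitOfRecord₁₃At 2 0 ρA ρB) …`
(take `K₀ := 0`, `jcut := jc F θ hP g₀ os`), FROM node U3's ONE-CONSTANT CLASS-MEASURE SANDWICH NE7-S_cl ALONE on the pushed-forward shell-free class laws of record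
`classMeasA₁₃ − shellMeasA₁₃ ρA` ∕ `classMeasB₁₃ − shellMeasB₁₃ ρB`, `Σ r < ∞` (§2 with the MGF-part form DISCHARGED by g2's shell sibling).  Neither (V) nor N14's (I)-binder is read;
the rates `PHolderD4 β …` are not read. [folklore] -/
theorem core_crOfRecord₁₃VAt_shellSplitOfRecord_of_classSandwich (ρA ρB : WidthLetter₁₃CoPH N) (E : B12.RunParams → ℝ) (hsel : θ.ppSel = ppSelLiveOfRecord F N θ.ν θ.τ9 E (wOfRecord₉ F N θ.toStage9Params))
    (hζm : ZetaMeasurable F N θ.ζ) (hζ0 : ∀ p g k s Pl Ql RS U V', 0 ≤ θ.ζ p g k s Pl Ql RS U V') (g₀ : ℕ → ℝ) (os : List (ULoop F)) {r : ℕ → ℝ}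
    (hS : letI : DecidableEq (Σ K, SiteSeqKey F (K₀ + K)) := Classical.decEq _
      ∀ K : ℕ, ∃ c : ℝ, ∀ t : ℝ, |t| ≤ 1 → ∀ x ∈ classSet₁₃ θ K₀ g₀ K \ badClass₁₃ θ K₀ g₀ jcut K t,
        ENNReal.ofReal (Real.exp (c - r K)) • (classMeasA₁₃ θ K₀ g₀ K x - shellMeasA₁₃ θ K₀ g₀ (ρA F θ hP g₀ os) K x).map ((T4RunLadder.unitFactorisation (datumOfRecord₁₃CoPH F N θ hP) (isPrintedAveraged_datumOfRecord₁₃CoPH F N θ hP).avgMeasurable g₀).A (K₀ + K)) ≤ (classMeasB₁₃ θ K₀ g₀ K x - shellMeasB₁₃ θ K₀ g₀ (ρB F θ hP g₀ os) K x).map ((T4RunLadder.unitFactorisation (datumOfRecord₁₃CoPH F N θ hP) (isPrintedAveraged_datumOfRecord₁₃CoPH F N θ hP).avgMeasurable g₀).A (K₀ + K + 1)) ∧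
        (classMeasB₁₃ θ K₀ g₀ K x - shellMeasB₁₃ θ K₀ g₀ (ρB F θ hP g₀ os) K x).map ((T4RunLadder.unitFactorisation (datumOfRecord₁₃CoPH F N θ hP) (isPrintedAveraged_datumOfRecord₁₃CoPH F N θ hP).avgMeasurable g₀).A (K₀ + K + 1)) ≤ ENNReal.ofReal (Real.exp (c + r K)) • (classMeasA₁₃ θ K₀ g₀ K x - shellMeasA₁₃ θ K₀ g₀ (ρA F θ hP g₀ os) K x).map ((T4RunLadder.unitFactorisation (datumOfRecord₁₃CoPH F N θ hP) (isPrintedAveraged_datumOfRecord₁₃CoPH F N θ hP).avgMeasurable g₀).A (K₀ + K)))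
    (hrs : Summable r) :
    (letI := (crOfRecord₁₃VAt K₀ jcut (shellSplitOfRecord₁₃At N K₀ ρA ρB) F θ hP g₀ os).dec
     NE7.Core (crOfRecord₁₃VAt K₀ jcut (shellSplitOfRecord₁₃At N K₀ ρA ρB) F θ hP g₀ os).l₀ (crOfRecord₁₃VAt K₀ jcut (shellSplitOfRecord₁₃At N K₀ ρA ρB) F θ hP g₀ os).vol
      (crOfRecord₁₃VAt K₀ jcut (shellSplitOfRecord₁₃At N K₀ ρA ρB) F θ hP g₀ os).T (crOfRecord₁₃VAt K₀ jcut (shellSplitOfRecord₁₃At N K₀ ρA ρB) F θ hP g₀ os).Bad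
      (fun K t τ => (crOfRecord₁₃VAt K₀ jcut (shellSplitOfRecord₁₃At N K₀ ρA ρB) F θ hP g₀ os).A K t τ - (crOfRecord₁₃VAt K₀ jcut (shellSplitOfRecord₁₃At N K₀ ρA ρB) F θ hP g₀ os).shA K t τ)
      (fun K t τ => (crOfRecord₁₃VAt K₀ jcut (shellSplitOfRecord₁₃At N K₀ ρA ρB) F θ hP g₀ os).B K t τ - (crOfRecord₁₃VAt K₀ jcut (shellSplitOfRecord₁₃At N K₀ ρA ρB) F θ hP g₀ os).shB K t τ)
      (crOfRecord₁₃VAt K₀ jcut (shellSplitOfRecord₁₃At N K₀ ρA ρB) F θ hP g₀ os).δ) ∧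
      Summable (crOfRecord₁₃VAt K₀ jcut (shellSplitOfRecord₁₃At N K₀ ρA ρB) F θ hP g₀ os).δ :=
  core_crOfRecord₁₃VAt_of_classSandwich θ hP K₀ jcut (shellSplitOfRecord₁₃At N K₀ ρA ρB) E hsel hζm hζ0 g₀ os
    (mgfForm_shellA₁₃ θ K₀ hP E hsel hζm hζ0 g₀ os (ρA F θ hP g₀ os)) (fun K x _ => shellMeasA₁₃_le θ K₀ hζm g₀ (ρA F θ hP g₀ os) K x)
    (mgfForm_shellB₁₃ θ K₀ hP E hsel hζm hζ0 g₀ os (ρB F θ hP g₀ os)) (fun K x _ => shellMeasB₁₃_le θ K₀ hζm g₀ (ρB F θ hP g₀ os) K x) hS hrs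

end ShellOfRecord₂

/-! ## §3 ROAD (iii)′: MASS_cl ∧ TV_cl of the shell-free class laws ⇒ the N19′ conjunct at the reading DIRECTLY (n19-c's sufficiency; NO (I)-binder) -/

section MassMap

variable {ι X : Type*} [DecidableEq ι] [MeasurableSpace X] {ΩA ΩB : ℕ → Type*} [∀ K, MeasurableSpace (ΩA K)] [∀ K, MeasurableSpace (ΩB K)]
  {l₀ : ℝ} {T : ℕ → Finset ι} {Bad : ℕ → ℝ → Finset ι} {μA : ∀ K, ι → Measure (ΩA K)} {μB : ∀ K, ι → Measure (ΩB K)} {r : ℕ → ℝ}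
  {a : ∀ K, ΩA K → X} {b : ∀ K, ΩB K → X}

/-- **MASS_cl PUSHES FORWARD UNCHANGED** (two keys; companion of dag-n19-c's `classSandwich_map` ∕ `tvSandwich_map`): a measurable key map does not change a mass, so the
one-constant mass sandwich of two runs' class pieces on their OWN spaces IS the mass sandwich of their push-forwards to the common space `X` — the `hM` of dag-n19-d's
`core_of_mass_of_tv_map₂` read on the original measures. [folklore] -/
theorem massSandwich_map₂ (ha : ∀ K, Measurable (a K)) (hb : ∀ K, Measurable (b K))
    (hM : ∀ K : ℕ, ∃ c : ℝ, ∀ t : ℝ, |t| ≤ l₀ → ∀ τ ∈ T K \ Bad K t,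
      ENNReal.ofReal (Real.exp (c - r K)) * μA K τ Set.univ ≤ μB K τ Set.univ ∧ μB K τ Set.univ ≤ ENNReal.ofReal (Real.exp (c + r K)) * μA K τ Set.univ) :
    ∀ K : ℕ, ∃ c : ℝ, ∀ t : ℝ, |t| ≤ l₀ → ∀ τ ∈ T K \ Bad K t,
      ENNReal.ofReal (Real.exp (c - r K)) * ((μA K τ).map (a K)) Set.univ ≤ ((μB K τ).map (b K)) Set.univ ∧
        ((μB K τ).map (b K)) Set.univ ≤ ENNReal.ofReal (Real.exp (c + r K)) * ((μA K τ).map (a K)) Set.univ := by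
  intro K
  obtain ⟨c, hc⟩ := hM K
  refine ⟨c, fun t ht τ hτ => ?_⟩
  rw [Measure.map_apply (ha K) MeasurableSet.univ, Measure.map_apply (hb K) MeasurableSet.univ, Set.preimage_univ, Set.preimage_univ]
  exact hc t ht τ hτ

end MassMap

/-- **★★ ROAD (iii)′ AT THE V READING OF RECORD, generic shell split in MGF-part form.**  At one Stage-13 tuple with core provisos on the live-selector line (laws (H-ζ) ∕ `0 ≤ ζ`):
MASS_cl — for every `K` ONE constant `c` with `e^{c − r₁ K}·mass(lawA) ≤ mass(lawB) ≤ e^{c + r₁ K}·mass(lawA)` for the shell-free class measures of record ON THE RUNS' OWN SPACES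
(dag-n19-c's `ℝ≥0∞` letters; a push-forward does not change a mass) — AND TV_cl — the NORMALISED pushed-forward shell-free class laws differ by `≤ ρ K` on every measurable set of the unit
lattice (g2's `hTV` VERBATIM) — on every good key, with `Σ r₁ < ∞`, `Σ ρ < ∞` ⇒ `NE7.Core` at `crOfRecord₁₃VAt K₀ jcut sh …`'s OWN carriers and canonical `δ`, `∧ Summable`, DIRECTLY
(dag-n19-d `core_of_mass_of_tv_map₂` over dag-n19-c `core_of_mass_of_tv`, width `r₁ + (e² − 1)·ρ` at `l₀ = B = 1`, + dag-n20-d `core_crOfRecord₁₃VAt`).  The input pair IS g2's road (ii)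
pair by §1; N14's (I)-binder is NOT read on this road. [folklore] -/
theorem core_crOfRecord₁₃VAt_of_massSandwich_of_tv (E : B12.RunParams → ℝ) (hsel : θ.ppSel = ppSelLiveOfRecord F N θ.ν θ.τ9 E (wOfRecord₉ F N θ.toStage9Params))
    (hζm : ZetaMeasurable F N θ.ζ) (hζ0 : ∀ p g k s Pl Ql RS U V', 0 ≤ θ.ζ p g k s Pl Ql RS U V') (g₀ : ℕ → ℝ) (os : List (ULoop F))
    {νshA : ∀ K, (Σ K, SiteSeqKey F (K₀ + K)) → Measure (GaugeField (F.P (K₀ + K)) 0 (Node00.SU N))}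
    {νshB : ∀ K, (Σ K, SiteSeqKey F (K₀ + K)) → Measure (GaugeField (F.P (K₀ + K + 1)) 0 (Node00.SU N))}
    (hshA : MGFForm 1 (classSet₁₃ θ K₀ g₀)
      (fun K (U : GaugeField (F.P (K₀ + K)) 0 (Node00.SU N)) => T4GenFunBounds.prodObs ((datumOfRecord₁₃CoPH F N θ hP).scheme g₀) (K₀ + K) os U) νshA (sh F θ hP g₀ os).1)
    (hleA : ∀ K, ∀ x ∈ classSet₁₃ θ K₀ g₀ K, νshA K x ≤ classMeasA₁₃ θ K₀ g₀ K x)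
    (hshB : MGFForm 1 (classSet₁₃ θ K₀ g₀)
      (fun K (U : GaugeField (F.P (K₀ + K + 1)) 0 (Node00.SU N)) => T4GenFunBounds.prodObs ((datumOfRecord₁₃CoPH F N θ hP).scheme g₀) (K₀ + K + 1) os U) νshB (sh F θ hP g₀ os).2)
    (hleB : ∀ K, ∀ x ∈ classSet₁₃ θ K₀ g₀ K, νshB K x ≤ classMeasB₁₃ θ K₀ g₀ K x) {r₁ ρ : ℕ → ℝ}
    (hM : letI : DecidableEq (Σ K, SiteSeqKey F (K₀ + K)) := Classical.decEq _
      ∀ K : ℕ, ∃ c : ℝ, ∀ t : ℝ, |t| ≤ 1 → ∀ x ∈ classSet₁₃ θ K₀ g₀ K \ badClass₁₃ θ K₀ g₀ jcut K t,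
        ENNReal.ofReal (Real.exp (c - r₁ K)) * (classMeasA₁₃ θ K₀ g₀ K x - νshA K x) Set.univ ≤ (classMeasB₁₃ θ K₀ g₀ K x - νshB K x) Set.univ ∧ (classMeasB₁₃ θ K₀ g₀ K x - νshB K x) Set.univ ≤ ENNReal.ofReal (Real.exp (c + r₁ K)) * (classMeasA₁₃ θ K₀ g₀ K x - νshA K x) Set.univ)
    (hTV : letI : DecidableEq (Σ K, SiteSeqKey F (K₀ + K)) := Classical.decEq _
      ∀ (K : ℕ) (t : ℝ), |t| ≤ 1 → ∀ x ∈ classSet₁₃ θ K₀ g₀ K \ badClass₁₃ θ K₀ g₀ jcut K t, ∀ S : Set (GaugeField (F.P 0) 0 (Node00.SU N)), MeasurableSet S →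
        |((classMeasB₁₃ θ K₀ g₀ K x - νshB K x).map ((T4RunLadder.unitFactorisation (datumOfRecord₁₃CoPH F N θ hP) (isPrintedAveraged_datumOfRecord₁₃CoPH F N θ hP).avgMeasurable g₀).A (K₀ + K + 1))).real S / ((classMeasB₁₃ θ K₀ g₀ K x - νshB K x).map ((T4RunLadder.unitFactorisation (datumOfRecord₁₃CoPH F N θ hP) (isPrintedAveraged_datumOfRecord₁₃CoPH F N θ hP).avgMeasurable g₀).A (K₀ + K + 1))).real Set.univ -
          ((classMeasA₁₃ θ K₀ g₀ K x - νshA K x).map ((T4RunLadder.unitFactorisation (datumOfRecord₁₃CoPH F N θ hP) (isPrintedAveraged_datumOfRecord₁₃CoPH F N θ hP).avgMeasurable g₀).A (K₀ + K))).real S / ((classMeasA₁₃ θ K₀ g₀ K x - νshA K x).map ((T4RunLadder.unitFactorisation (datumOfRecord₁₃CoPH F N θ hP) (isPrintedAveraged_datumOfRecord₁₃CoPH F N θ hP).avgMeasurable g₀).A (K₀ + K))).real Set.univ| ≤ ρ K)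
    (hr₁ : Summable r₁) (hρ : Summable ρ) :
    (letI := (crOfRecord₁₃VAt K₀ jcut sh F θ hP g₀ os).dec
     NE7.Core (crOfRecord₁₃VAt K₀ jcut sh F θ hP g₀ os).l₀ (crOfRecord₁₃VAt K₀ jcut sh F θ hP g₀ os).vol
      (crOfRecord₁₃VAt K₀ jcut sh F θ hP g₀ os).T (crOfRecord₁₃VAt K₀ jcut sh F θ hP g₀ os).Bad
      (fun K t τ => (crOfRecord₁₃VAt K₀ jcut sh F θ hP g₀ os).A K t τ - (crOfRecord₁₃VAt K₀ jcut sh F θ hP g₀ os).shA K t τ)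
      (fun K t τ => (crOfRecord₁₃VAt K₀ jcut sh F θ hP g₀ os).B K t τ - (crOfRecord₁₃VAt K₀ jcut sh F θ hP g₀ os).shB K t τ)
      (crOfRecord₁₃VAt K₀ jcut sh F θ hP g₀ os).δ) ∧
      Summable (crOfRecord₁₃VAt K₀ jcut sh F θ hP g₀ os).δ := by
  letI : DecidableEq (Σ K, SiteSeqKey F (K₀ + K)) := Classical.decEq _
  have hA := (mgfForm_weightA₁₃ θ K₀ hP E hsel hζm hζ0 g₀ os).sub hshA hleA
  have hB := (mgfForm_weightB₁₃ θ K₀ hP E hsel hζm hζ0 g₀ os).sub hshB hleB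
  have hP0 : ∀ (K : ℕ) (t : ℝ), |t| ≤ 1 → ∀ x ∈ classSet₁₃ θ K₀ g₀ K \ badClass₁₃ θ K₀ g₀ jcut K t,
      0 ≤ weightA₁₃ θ hP K₀ g₀ os K t x - (sh F θ hP g₀ os).1 K t x := fun K t _ x hx => hA.nonneg' K t (Finset.mem_sdiff.1 hx).1
  have hvol : (0 : ℝ) < (F.side : ℝ) ^ 4 := pow_pos F.side_pos 4
  set Nf := (T4RunLadder.unitFactorisation (datumOfRecord₁₃CoPH F N θ hP) (isPrintedAveraged_datumOfRecord₁₃CoPH F N θ hP).avgMeasurable g₀) with hNf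
  have hφA : (fun K (U : GaugeField (F.P (K₀ + K)) 0 (Node00.SU N)) => T4GenFunBounds.prodObs ((datumOfRecord₁₃CoPH F N θ hP).scheme g₀) (K₀ + K) os U) =
      fun K => (fun u => (os.map fun o => Nf.W o u).prod) ∘ Nf.A (K₀ + K) :=
    funext fun K => prodObs_eq_prodW_comp_A Nf (K₀ + K) os
  have hφB : (fun K (U : GaugeField (F.P (K₀ + K + 1)) 0 (Node00.SU N)) => T4GenFunBounds.prodObs ((datumOfRecord₁₃CoPH F N θ hP).scheme g₀) (K₀ + K + 1) os U) =
      fun K => (fun u => (os.map fun o => Nf.W o u).prod) ∘ Nf.A (K₀ + K + 1) :=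
    funext fun K => prodObs_eq_prodW_comp_A Nf (K₀ + K + 1) os
  rw [hφA] at hA; rw [hφB] at hB
  -- a push-forward does not change a mass
  have hM' := massSandwich_map₂ (T := classSet₁₃ θ K₀ g₀) (Bad := badClass₁₃ θ K₀ g₀ jcut) (l₀ := 1) (r := r₁)
    (ΩA := fun K => GaugeField (F.P (K₀ + K)) 0 (Node00.SU N)) (ΩB := fun K => GaugeField (F.P (K₀ + K + 1)) 0 (Node00.SU N))
    (μA := fun K x => classMeasA₁₃ θ K₀ g₀ K x - νshA K x) (μB := fun K x => classMeasB₁₃ θ K₀ g₀ K x - νshB K x)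
    (a := fun K => Nf.A (K₀ + K)) (b := fun K => Nf.A (K₀ + K + 1)) (fun K => Nf.measurable_A (K₀ + K)) (fun K => Nf.measurable_A (K₀ + K + 1)) hM
  have hcore := core_of_mass_of_tv_map₂ (T := classSet₁₃ θ K₀ g₀) (Bad := badClass₁₃ θ K₀ g₀ jcut) (l₀ := 1) (vol := (F.side : ℝ) ^ 4) (B := 1)
    (ΩA := fun K => GaugeField (F.P (K₀ + K)) 0 (Node00.SU N)) (ΩB := fun K => GaugeField (F.P (K₀ + K + 1)) 0 (Node00.SU N))
    (a := fun K => Nf.A (K₀ + K)) (b := fun K => Nf.A (K₀ + K + 1))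
    (νA := fun K x => classMeasA₁₃ θ K₀ g₀ K x - νshA K x) (νB := fun K x => classMeasB₁₃ θ K₀ g₀ K x - νshB K x) (r₁ := r₁) (ρ := ρ)
    (δ := fun K => (r₁ K + (Real.exp (2 * (1 * 1)) - 1) * ρ K) / (F.side : ℝ) ^ 4)
    (fun K => Nf.measurable_A (K₀ + K)) (fun K => Nf.measurable_A (K₀ + K + 1)) (measurable_prodW Nf os) (abs_prodW_le_one Nf os) hA hB hM' hTV
    (fun K => (mul_div_cancel₀ _ hvol.ne').symm.le)
  exact core_crOfRecord₁₃VAt K₀ jcut sh θ hP g₀ os hP0 hcore ((hr₁.add (hρ.mul_left _)).div_const _)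

section ShellOfRecord₃

open Summit.QuantumFields.YangMills.Theorems.N21ShellSplitOfRecord13CoPH (shellSplitOfRecord₁₃At WidthLetter₁₃CoPH)
open YMDAG.N14.AtSpineReading13CoPH.Shell

/-- **★★ ROAD (iii)′ AT THE V READING WITH n21-d's SHELL SPLIT OF RECORD** — K3⁷ v4 stub 2's N19′ conjunct at a live tuple (and `g₀ ∕ os`), `cr … = crOfRecord₁₃V (jc …) (shellSplitOfRecord₁₃At 2 0 ρA ρB) …`,
FROM node U3's PAIR (MASS_cl(`r₁`) of the shell-free class measures of record `classMeasA₁₃ − shellMeasA₁₃ ρA` ∕ `classMeasB₁₃ − shellMeasB₁₃ ρB`, TV_cl(`ρ`) of their normalised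
push-forwards to the unit lattice — g2's `hTV` VERBATIM), `Σ r₁, Σ ρ < ∞`, DIRECTLY (§3 with the MGF-part form DISCHARGED by g2's shell sibling).  By §1 this is g2's
`core_crOfRecord₁₃VAt_shellSplitOfRecord_of_coreZero_of_tv` with (V) read in measure words — and WITHOUT N14's (I)-binder in the proof. [folklore] -/
theorem core_crOfRecord₁₃VAt_shellSplitOfRecord_of_massSandwich_of_tv (ρA ρB : WidthLetter₁₃CoPH N) (E : B12.RunParams → ℝ) (hsel : θ.ppSel = ppSelLiveOfRecord F N θ.ν θ.τ9 E (wOfRecord₉ F N θ.toStage9Params))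
    (hζm : ZetaMeasurable F N θ.ζ) (hζ0 : ∀ p g k s Pl Ql RS U V', 0 ≤ θ.ζ p g k s Pl Ql RS U V') (g₀ : ℕ → ℝ) (os : List (ULoop F)) {r₁ ρ : ℕ → ℝ}
    (hM : letI : DecidableEq (Σ K, SiteSeqKey F (K₀ + K)) := Classical.decEq _
      ∀ K : ℕ, ∃ c : ℝ, ∀ t : ℝ, |t| ≤ 1 → ∀ x ∈ classSet₁₃ θ K₀ g₀ K \ badClass₁₃ θ K₀ g₀ jcut K t,
        ENNReal.ofReal (Real.exp (c - r₁ K)) * (classMeasA₁₃ θ K₀ g₀ K x - shellMeasA₁₃ θ K₀ g₀ (ρA F θ hP g₀ os) K x) Set.univ ≤ (classMeasB₁₃ θ K₀ g₀ K x - shellMeasB₁₃ θ K₀ g₀ (ρB F θ hP g₀ os) K x) Set.univ ∧ (classMeasB₁₃ θ K₀ g₀ K x - shellMeasB₁₃ θ K₀ g₀ (ρB F θ hP g₀ os) K x) Set.univ ≤ ENNReal.ofReal (Real.exp (c + r₁ K)) * (classMeasA₁₃ θ K₀ g₀ K x - shellMeasA₁₃ θ K₀ g₀ (ρA F θ hP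 g₀ os) K x) Set.univ)
    (hTV : letI : DecidableEq (Σ K, SiteSeqKey F (K₀ + K)) := Classical.decEq _
      ∀ (K : ℕ) (t : ℝ), |t| ≤ 1 → ∀ x ∈ classSet₁₃ θ K₀ g₀ K \ badClass₁₃ θ K₀ g₀ jcut K t, ∀ S : Set (GaugeField (F.P 0) 0 (Node00.SU N)), MeasurableSet S →
        |((classMeasB₁₃ θ K₀ g₀ K x - shellMeasB₁₃ θ K₀ g₀ (ρB F θ hP g₀ os) K x).map ((T4RunLadder.unitFactorisation (datumOfRecord₁₃CoPH F N θ hP) (isPrintedAveraged_datumOfRecord₁₃CoPH F N θ hP).avgMeasurable g₀).A (K₀ + K + 1))).real S / ((classMeasB₁₃ θ K₀ g₀ K x - shellMeasB₁₃ θ K₀ g₀ (ρB F θ hP g₀ os) K x).map ((T4RunLadder.unitFactorisation (datumOfRecord₁₃CoPH F N θ hP) (isPrintedAveraged_datumOfRecord₁₃CoPH F N θ hP).avgMeasurable g₀).A (K₀ + K + 1))).real Set.univ -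
          ((classMeasA₁₃ θ K₀ g₀ K x - shellMeasA₁₃ θ K₀ g₀ (ρA F θ hP g₀ os) K x).map ((T4RunLadder.unitFactorisation (datumOfRecord₁₃CoPH F N θ hP) (isPrintedAveraged_datumOfRecord₁₃CoPH F N θ hP).avgMeasurable g₀).A (K₀ + K))).real S / ((classMeasA₁₃ θ K₀ g₀ K x - shellMeasA₁₃ θ K₀ g₀ (ρA F θ hP g₀ os) K x).map ((T4RunLadder.unitFactorisation (datumOfRecord₁₃CoPH F N θ hP) (isPrintedAveraged_datumOfRecord₁₃CoPH F N θ hP).avgMeasurable g₀).A (K₀ + K))).real Set.univ| ≤ ρ K)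
    (hr₁ : Summable r₁) (hρ : Summable ρ) :
    (letI := (crOfRecord₁₃VAt K₀ jcut (shellSplitOfRecord₁₃At N K₀ ρA ρB) F θ hP g₀ os).dec
     NE7.Core (crOfRecord₁₃VAt K₀ jcut (shellSplitOfRecord₁₃At N K₀ ρA ρB) F θ hP g₀ os).l₀ (crOfRecord₁₃VAt K₀ jcut (shellSplitOfRecord₁₃At N K₀ ρA ρB) F θ hP g₀ os).vol
      (crOfRecord₁₃VAt K₀ jcut (shellSplitOfRecord₁₃At N K₀ ρA ρB) F θ hP g₀ os).T (crOfRecord₁₃VAt K₀ jcut (shellSplitOfRecord₁₃At N K₀ ρA ρB) F θ hP g₀ os).Bad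
      (fun K t τ => (crOfRecord₁₃VAt K₀ jcut (shellSplitOfRecord₁₃At N K₀ ρA ρB) F θ hP g₀ os).A K t τ - (crOfRecord₁₃VAt K₀ jcut (shellSplitOfRecord₁₃At N K₀ ρA ρB) F θ hP g₀ os).shA K t τ)
      (fun K t τ => (crOfRecord₁₃VAt K₀ jcut (shellSplitOfRecord₁₃At N K₀ ρA ρB) F θ hP g₀ os).B K t τ - (crOfRecord₁₃VAt K₀ jcut (shellSplitOfRecord₁₃At N K₀ ρA ρB) F θ hP g₀ os).shB K t τ)
      (crOfRecord₁₃VAt K₀ jcut (shellSplitOfRecord₁₃At N K₀ ρA ρB) F θ hP g₀ os).δ) ∧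
      Summable (crOfRecord₁₃VAt K₀ jcut (shellSplitOfRecord₁₃At N K₀ ρA ρB) F θ hP g₀ os).δ :=
  core_crOfRecord₁₃VAt_of_massSandwich_of_tv θ hP K₀ jcut (shellSplitOfRecord₁₃At N K₀ ρA ρB) E hsel hζm hζ0 g₀ os
    (mgfForm_shellA₁₃ θ K₀ hP E hsel hζm hζ0 g₀ os (ρA F θ hP g₀ os)) (fun K x _ => shellMeasA₁₃_le θ K₀ hζm g₀ (ρA F θ hP g₀ os) K x)
    (mgfForm_shellB₁₃ θ K₀ hP E hsel hζm hζ0 g₀ os (ρB F θ hP g₀ os)) (fun K x _ => shellMeasB₁₃_le θ K₀ hζm g₀ (ρB F θ hP g₀ os) K x) hM hTV hr₁ hρ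

/-! ## §4 ROAD (iii)″: MASS_cl ∧ SHAPE_cl (density form) of the shell-free class laws of record ⇒ the N19′ conjunct (NE7-S_cl of width `r₁ + 2r₂`, then §2) -/

/-- **★ ROAD (iii)″ AT THE V READING WITH n21-d's SHELL SPLIT OF RECORD** — the N19′ conjunct at a live tuple FROM MASS_cl(`r₁`) of the shell-free class measures of record AND SHAPE_cl IN
DENSITY FORM (dag-n19-w2's `hSh` ∕ g2 §1's text, on the SHELL-FREE laws): on every good key the pushed-forward shell-free law of run B IS `e^{c}` times run A's with a density `e^{g}`,
`g` measurable, `|g| ≤ r₂ K`; `Σ r₁, Σ r₂ < ∞`.  Mechanism: `shapeSandwich_of_shapeDensity` + `classSandwich_of_mass_of_shape` (dag-n19-c p496221: NE7-S_cl of width `r₁ + 2r₂` on the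
unit lattice, finite pieces) + §2.  N14's (I)-binder — automatic under SHAPE (g2 V §1 `tiltedMeanMatching_crOfRecord₁₃VAt_of_shapeDensity`) — is NOT read. [folklore] -/
theorem core_crOfRecord₁₃VAt_shellSplitOfRecord_of_massSandwich_of_shapeDensity (ρA ρB : WidthLetter₁₃CoPH N) (E : B12.RunParams → ℝ) (hsel : θ.ppSel = ppSelLiveOfRecord F N θ.ν θ.τ9 E (wOfRecord₉ F N θ.toStage9Params))
    (hζm : ZetaMeasurable F N θ.ζ) (hζ0 : ∀ p g k s Pl Ql RS U V', 0 ≤ θ.ζ p g k s Pl Ql RS U V') (g₀ : ℕ → ℝ) (os : List (ULoop F)) {r₁ r₂ : ℕ → ℝ}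
    (hM : letI : DecidableEq (Σ K, SiteSeqKey F (K₀ + K)) := Classical.decEq _
      ∀ K : ℕ, ∃ c : ℝ, ∀ t : ℝ, |t| ≤ 1 → ∀ x ∈ classSet₁₃ θ K₀ g₀ K \ badClass₁₃ θ K₀ g₀ jcut K t,
        ENNReal.ofReal (Real.exp (c - r₁ K)) * (classMeasA₁₃ θ K₀ g₀ K x - shellMeasA₁₃ θ K₀ g₀ (ρA F θ hP g₀ os) K x) Set.univ ≤ (classMeasB₁₃ θ K₀ g₀ K x - shellMeasB₁₃ θ K₀ g₀ (ρB F θ hP g₀ os) K x) Set.univ ∧ (classMeasB₁₃ θ K₀ g₀ K x - shellMeasB₁₃ θ K₀ g₀ (ρB F θ hP g₀ os) K x) Set.univ ≤ ENNReal.ofReal (Real.exp (c + r₁ K)) * (classMeasA₁₃ θ K₀ g₀ K x - shellMeasA₁₃ θ K₀ g₀ (ρA F θ hP g₀ os) K x) Set.univ)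
    (hSh : letI : DecidableEq (Σ K, SiteSeqKey F (K₀ + K)) := Classical.decEq _
      ∀ (K : ℕ) (t : ℝ), |t| ≤ 1 → ∀ x ∈ classSet₁₃ θ K₀ g₀ K \ badClass₁₃ θ K₀ g₀ jcut K t,
        ∃ (c : ℝ) (g : GaugeField (F.P 0) 0 (Node00.SU N) → ℝ), Measurable g ∧ (∀ u, |g u| ≤ r₂ K) ∧
          (classMeasB₁₃ θ K₀ g₀ K x - shellMeasB₁₃ θ K₀ g₀ (ρB F θ hP g₀ os) K x).map ((T4RunLadder.unitFactorisation (datumOfRecord₁₃CoPH F N θ hP) (isPrintedAveraged_datumOfRecord₁₃CoPH F N θ hP).avgMeasurable g₀).A (K₀ + K + 1)) =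
            ENNReal.ofReal (Real.exp c) • ((classMeasA₁₃ θ K₀ g₀ K x - shellMeasA₁₃ θ K₀ g₀ (ρA F θ hP g₀ os) K x).map ((T4RunLadder.unitFactorisation (datumOfRecord₁₃CoPH F N θ hP) (isPrintedAveraged_datumOfRecord₁₃CoPH F N θ hP).avgMeasurable g₀).A (K₀ + K))).withDensity fun u => ENNReal.ofReal (Real.exp (g u)))
    (hr₁ : Summable r₁) (hr₂ : Summable r₂) :
    (letI := (crOfRecord₁₃VAt K₀ jcut (shellSplitOfRecord₁₃At N K₀ ρA ρB) F θ hP g₀ os).dec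
     NE7.Core (crOfRecord₁₃VAt K₀ jcut (shellSplitOfRecord₁₃At N K₀ ρA ρB) F θ hP g₀ os).l₀ (crOfRecord₁₃VAt K₀ jcut (shellSplitOfRecord₁₃At N K₀ ρA ρB) F θ hP g₀ os).vol
      (crOfRecord₁₃VAt K₀ jcut (shellSplitOfRecord₁₃At N K₀ ρA ρB) F θ hP g₀ os).T (crOfRecord₁₃VAt K₀ jcut (shellSplitOfRecord₁₃At N K₀ ρA ρB) F θ hP g₀ os).Bad
      (fun K t τ => (crOfRecord₁₃VAt K₀ jcut (shellSplitOfRecord₁₃At N K₀ ρA ρB) F θ hP g₀ os).A K t τ - (crOfRecord₁₃VAt K₀ jcut (shellSplitOfRecord₁₃At N K₀ ρA ρB) F θ hP g₀ os).shA K t τ)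
      (fun K t τ => (crOfRecord₁₃VAt K₀ jcut (shellSplitOfRecord₁₃At N K₀ ρA ρB) F θ hP g₀ os).B K t τ - (crOfRecord₁₃VAt K₀ jcut (shellSplitOfRecord₁₃At N K₀ ρA ρB) F θ hP g₀ os).shB K t τ)
      (crOfRecord₁₃VAt K₀ jcut (shellSplitOfRecord₁₃At N K₀ ρA ρB) F θ hP g₀ os).δ) ∧
      Summable (crOfRecord₁₃VAt K₀ jcut (shellSplitOfRecord₁₃At N K₀ ρA ρB) F θ hP g₀ os).δ := by
  letI : DecidableEq (Σ K, SiteSeqKey F (K₀ + K)) := Classical.decEq _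
  set Nf := (T4RunLadder.unitFactorisation (datumOfRecord₁₃CoPH F N θ hP) (isPrintedAveraged_datumOfRecord₁₃CoPH F N θ hP).avgMeasurable g₀) with hNf
  have hfin : ∀ K, ∀ x ∈ classSet₁₃ θ K₀ g₀ K,
      (Measure.map (α := GaugeField (F.P (K₀ + K)) 0 (Node00.SU N)) (Nf.A (K₀ + K))
        (classMeasA₁₃ θ K₀ g₀ K x - shellMeasA₁₃ θ K₀ g₀ (ρA F θ hP g₀ os) K x)) Set.univ ≠ ∞ := fun K x _ => by
    haveI := isFiniteMeasure_classMeasA₁₃ θ K₀ hP hζm g₀ K x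
    haveI : IsFiniteMeasure (classMeasA₁₃ θ K₀ g₀ K x - shellMeasA₁₃ θ K₀ g₀ (ρA F θ hP g₀ os) K x) :=
      isFiniteMeasure_of_le _ Measure.sub_le
    exact measure_ne_top _ _
  -- a push-forward does not change a mass
  have hM' := massSandwich_map₂ (T := classSet₁₃ θ K₀ g₀) (Bad := badClass₁₃ θ K₀ g₀ jcut) (l₀ := 1) (r := r₁)
    (ΩA := fun K => GaugeField (F.P (K₀ + K)) 0 (Node00.SU N)) (ΩB := fun K => GaugeField (F.P (K₀ + K + 1)) 0 (Node00.SU N))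
    (μA := fun K x => classMeasA₁₃ θ K₀ g₀ K x - shellMeasA₁₃ θ K₀ g₀ (ρA F θ hP g₀ os) K x)
    (μB := fun K x => classMeasB₁₃ θ K₀ g₀ K x - shellMeasB₁₃ θ K₀ g₀ (ρB F θ hP g₀ os) K x)
    (a := fun K => Nf.A (K₀ + K)) (b := fun K => Nf.A (K₀ + K + 1)) (fun K => Nf.measurable_A (K₀ + K)) (fun K => Nf.measurable_A (K₀ + K + 1)) hM
  have hS := classSandwich_of_mass_of_shape (Ω := fun _ => GaugeField (F.P 0) 0 (Node00.SU N)) (T := classSet₁₃ θ K₀ g₀) (Bad := badClass₁₃ θ K₀ g₀ jcut) (l₀ := 1)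
    (μA := fun K x => Measure.map (α := GaugeField (F.P (K₀ + K)) 0 (Node00.SU N)) (Nf.A (K₀ + K)) (classMeasA₁₃ θ K₀ g₀ K x - shellMeasA₁₃ θ K₀ g₀ (ρA F θ hP g₀ os) K x))
    (μB := fun K x => Measure.map (α := GaugeField (F.P (K₀ + K + 1)) 0 (Node00.SU N)) (Nf.A (K₀ + K + 1)) (classMeasB₁₃ θ K₀ g₀ K x - shellMeasB₁₃ θ K₀ g₀ (ρB F θ hP g₀ os) K x))
    hfin hM' (shapeSandwich_of_shapeDensity (Ω := fun _ => GaugeField (F.P 0) 0 (Node00.SU N)) (T := classSet₁₃ θ K₀ g₀) (Bad := badClass₁₃ θ K₀ g₀ jcut) (l₀ := 1)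
      (μA := fun K x => Measure.map (α := GaugeField (F.P (K₀ + K)) 0 (Node00.SU N)) (Nf.A (K₀ + K)) (classMeasA₁₃ θ K₀ g₀ K x - shellMeasA₁₃ θ K₀ g₀ (ρA F θ hP g₀ os) K x))
      (μB := fun K x => Measure.map (α := GaugeField (F.P (K₀ + K + 1)) 0 (Node00.SU N)) (Nf.A (K₀ + K + 1)) (classMeasB₁₃ θ K₀ g₀ K x - shellMeasB₁₃ θ K₀ g₀ (ρB F θ hP g₀ os) K x)) hSh)
  exact core_crOfRecord₁₃VAt_shellSplitOfRecord_of_classSandwich θ hP K₀ jcut ρA ρB E hsel hζm hζ0 g₀ os hS (hr₁.add (hr₂.mul_left 2))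

end ShellOfRecord₃

end YMDAG.N14.AtSpineReading13CoPH.V.ClassLawRoads

end
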